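/-
Copyright: the b2b-balaban T⁴-continuum CRUX team, row NE7b OWNER lineage `t4-ne7b-p1` (gen 106). Project licence.
-/
import Summits.QuantumFields.BalabanUV.T4Continuum.Spine.NE7b.ConvexTiltMoment
import Summits.QuantumFields.BalabanUV.T4Continuum.Spine.NE7b.CarrierOnSupport

/-!
# `LocCondStability` BY NAME for the CONVEXITY-ROAD carrier: `M = (∫e^{−V}) ∕ (∫e^{−(V+g)})` — the sacrificed exponential moment under a
# uniformly convex exponent — inhabits the road's named `Prop` with `b ≥ Σ_k q_k(λ⁻¹‖u_k‖² + m_k²)` displayed `y`-uniformly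
# (row NE7b, node U5c; kernel junction — the convexity-road companion of `…PerturbedCarrierLCS` and `…CompactFibreLCS`)

Cell `pub-balaban`, sub-cell `t4`, spine estimate NE7b (`T4WeightBudget.RelWeightBound`; the cell's OWN estimate — NOT PRINTED in
[Bałaban 1983–89], NOT PROVED).  Crux-route work under `Spine/NE7b/` by the row's OWNER; NOTHING of Bałaban's is named or asserted;
no `T4Continuum/Support` leaf typed; no `def`; zero `sorry`.

WHY.  `…NE7b.ConvexTiltMoment.exp_moment_le_of_uniformlyConvex` (T-60a′) bounds, per background, the carrier of the convexity road —
`M = ∫e^{−V} ∕ ∫e^{−(V+g)}` with `W = V + g` the full exponent of the one-step kernel in the fresh variables and `g = Σ_k q_k⟪u_k,·⟫²`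
the sacrificed form — by `exp(Σ_k q_k(λ⁻¹‖u_k‖² + m_k²))`.  THIS FILE is the junction BY NAME to the road's ONE residual `Prop`
`…LocalConditionalStability.LocCondStability`, exactly as `…PerturbedCarrierLCS` (sandwich road) and `…CompactFibreLCS` (compact fibre):
per pattern prefix `g` of a level `j < K` and background `y`, data on `EuclideanSpace ℝ (Fin (n j g))` depending on `(j, g, y)` —
exponent `V`, modulus `lam`, ranks `r`, weights `q`, directions `u` —, the hypotheses of T-60a′ asked ON THE SUPPORT OF THE TERM, and a
`y`-UNIFORM budget `Σ_k q_k(λ⁻¹‖u_k‖² + m_k²) ≤ b j g` (the (R1″)-class tilted-mean letter inside) ⟹ `LocCondStability T S K μ ρ₀ M b`.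

WHAT IS PROVED ([folklore]; plumbing over T-60a′ and the gen-105 `locCondStability_of_carrier_le_on_support`): `convexCarrier_nonneg`,
`convexCarrier_le`, **`locCondStability_of_convexCarrier_on_support`**.

NOT HERE (honest): the data for Bałaban's steps ((A3); the convexity modulus on print's windows; the tilted means `m_k` by value);
anything of Bałaban's.  NE7b NOT PRINTED ∕ NOT PROVED; spine PROVED 0∕9; rung (B)+1 on a FINITE torus — NOT infinite volume, NOT the mass
gap, NOT Clay.
HONEST DEPENDENCY: continuum YM on T⁴ ⇐ BetaPertH ∧ nine spine estimates (0/9 proved); BetaPertH ⇐ (D1) ∧ (D4) ∧ CAP+tail.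
-/

set_option autoImplicit false

noncomputable section

open MeasureTheory Real Finset
open scoped RealInnerProductSpace
open Summit.QuantumFields.BalabanUV.T4Continuum.B16HistoryIndexedRepr Summit.QuantumFields.BalabanUV.T4Continuum.B16HistoryReprChain
open Summit.QuantumFields.BalabanUV.T4Continuum.NE7b.PrefixExtraction Summit.QuantumFields.BalabanUV.T4Continuum.NE7b.LocalConditionalStability
open Summit.QuantumFields.BalabanUV.T4Continuum.NE7b.CarrierOnSupport
open Summit.QuantumFields.BalabanUV.T4Continuum.NE7b.ConvexTiltMoment

namespace Summit.QuantumFields.BalabanUV.T4Continuum.NE7b.ConvexTiltLCS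

/-! ## §1 One background: the convexity-road carrier is non-negative and at most `e^{b}` -/

section OneBackground

variable {n : ℕ}

/-- The convexity-road carrier `∫e^{−V} ∕ ∫e^{−(V+g)}` is non-negative. [folklore] -/
theorem convexCarrier_nonneg (V : EuclideanSpace ℝ (Fin n) → ℝ) {r : ℕ} (q : Fin r → ℝ) (u : Fin r → EuclideanSpace ℝ (Fin n)) :
    0 ≤ (∫ x, exp (-V x)) / ∫ x, exp (-(V x + ∑ k, q k * ⟪u k, x⟫ ^ 2)) :=
  div_nonneg (integral_nonneg fun _ => (exp_pos _).le) (integral_nonneg fun _ => (exp_pos _).le)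

/-- **THE CONVEXITY-ROAD CARRIER OF ONE BACKGROUND IS AT MOST `e^{b}`** under the hypotheses of
`…ConvexTiltMoment.exp_moment_le_of_uniformlyConvex` and the budget `Σ_k q_k(λ⁻¹‖u_k‖² + m_k²) ≤ b`. [folklore] -/
theorem convexCarrier_le {V : EuclideanSpace ℝ (Fin n) → ℝ} {lam b : ℝ} {r : ℕ} (hlam : 0 < lam) (hVc : Continuous V)
    (hV : ∀ x y : EuclideanSpace ℝ (Fin n), V x + ⟪gradient V x, y - x⟫ + lam / 2 * ‖y - x‖ ^ 2 ≤ V y)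
    (hZ : Integrable fun x => exp (-V x)) (q : Fin r → ℝ) (hq : ∀ k, 0 ≤ q k) (u : Fin r → EuclideanSpace ℝ (Fin n))
    (h1 : ∀ k, Integrable (fun x => ⟪u k, x⟫) (volume.tilted fun x => -V x))
    (h2 : ∀ k, Integrable (fun x => ⟪u k, x⟫ ^ 2) (volume.tilted fun x => -V x))
    (hb : ∑ k, q k * (lam⁻¹ * ‖u k‖ ^ 2 + (∫ x, ⟪u k, x⟫ ∂(volume.tilted fun x => -V x)) ^ 2) ≤ b) :
    (∫ x, exp (-V x)) / (∫ x, exp (-(V x + ∑ k, q k * ⟪u k, x⟫ ^ 2))) ≤ exp b := by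
  refine div_le_of_le_mul₀ (integral_nonneg fun _ => (exp_pos _).le) (exp_pos _).le ?_
  exact (exp_moment_le_of_uniformlyConvex hlam hVc hV hZ q hq u h1 h2).trans
    (mul_le_mul_of_nonneg_right (exp_le_exp.2 hb) (integral_nonneg fun _ => (exp_pos _).le))

end OneBackground

/-! ## §2 The junction: `LocCondStability` by name for the convexity-road carrier, from data displayed on the support -/

section Junction

variable {P : Type} [DecidableEq P] {C : ℕ → Type} {𝒢 : (j : ℕ) → GoodClass (C j)}

/-- **LCS FOR A BACKGROUND-DEPENDENT CONVEXITY-ROAD CARRIER, ON THE SUPPORT.**  At every pattern prefix `g` of a level `j < K` and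
every background `y` let `M j g y = (∫e^{−V}) ∕ (∫e^{−(V+g)})` for the data at `(j, g, y)` on `EuclideanSpace ℝ (Fin (n j g))` —
exponent `V j g y`, sacrificed form `Σ_k q_k⟪u_k,·⟫²` with `r j g` terms —; suppose `M j g` is a.e.-strongly measurable and ON THE
SUPPORT OF THE TERM the hypotheses of T-60a′ hold with the `y`-UNIFORM modulus `lam j g > 0` and the `y`-UNIFORM budget
`Σ_k q_k(λ⁻¹‖u_k‖² + m_k²) ≤ b j g`.  Then `LocCondStability T S K μ ρ₀ M b`, integrability conjunct included. [folklore] -/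
theorem locCondStability_of_convexCarrier_on_support (T : Tower P C 𝒢) (Spat : (j : ℕ) → (Fin j → P) → Finset P)
    (K : ℕ) [∀ j, MeasurableSpace (C j)] (μ : (j : ℕ) → Measure (C j)) (ρ₀ : C 0 → ℝ)
    (M : (j : ℕ) → (Fin j → P) → C j → ℝ)
    (n r : (j : ℕ) → (Fin j → P) → ℕ)
    (V : (j : ℕ) → (g : Fin j → P) → C j → EuclideanSpace ℝ (Fin (n j g)) → ℝ)
    (q : (j : ℕ) → (g : Fin j → P) → C j → Fin (r j g) → ℝ)
    (u : (j : ℕ) → (g : Fin j → P) → C j → Fin (r j g) → EuclideanSpace ℝ (Fin (n j g)))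
    (lam b : (j : ℕ) → (Fin j → P) → ℝ) (hρ : (𝒢 0).Gd ρ₀) (h0 : ∀ x, 0 ≤ ρ₀ x)
    (hM : ∀ j g, j < K → g ∈ admS T Spat j → ∀ y, M j g y =
      (∫ x, exp (-V j g y x)) / ∫ x, exp (-(V j g y x + ∑ k, q j g y k * ⟪u j g y k, x⟫ ^ 2)))
    (hMm : ∀ j g, j < K → g ∈ admS T Spat j → AEStronglyMeasurable (M j g) (μ j))
    (hlam : ∀ j g, j < K → g ∈ admS T Spat j → 0 < lam j g)
    (hVc : ∀ j g, j < K → g ∈ admS T Spat j → ∀ y, T.eterm ρ₀ j g y ≠ 0 → Continuous (V j g y))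
    (hV : ∀ j g, j < K → g ∈ admS T Spat j → ∀ y, T.eterm ρ₀ j g y ≠ 0 → ∀ x z : EuclideanSpace ℝ (Fin (n j g)),
      V j g y x + ⟪gradient (V j g y) x, z - x⟫ + lam j g / 2 * ‖z - x‖ ^ 2 ≤ V j g y z)
    (hZ : ∀ j g, j < K → g ∈ admS T Spat j → ∀ y, T.eterm ρ₀ j g y ≠ 0 → Integrable fun x => exp (-V j g y x))
    (hq : ∀ j g, j < K → g ∈ admS T Spat j → ∀ y k, 0 ≤ q j g y k)
    (h1 : ∀ j g, j < K → g ∈ admS T Spat j → ∀ y, T.eterm ρ₀ j g y ≠ 0 → ∀ k,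
      Integrable (fun x => ⟪u j g y k, x⟫) (volume.tilted fun x => -V j g y x))
    (h2 : ∀ j g, j < K → g ∈ admS T Spat j → ∀ y, T.eterm ρ₀ j g y ≠ 0 → ∀ k,
      Integrable (fun x => ⟪u j g y k, x⟫ ^ 2) (volume.tilted fun x => -V j g y x))
    (hb : ∀ j g, j < K → g ∈ admS T Spat j → ∀ y, T.eterm ρ₀ j g y ≠ 0 →
      ∑ k, q j g y k * ((lam j g)⁻¹ * ‖u j g y k‖ ^ 2 + (∫ x, ⟪u j g y k, x⟫ ∂(volume.tilted fun x => -V j g y x)) ^ 2) ≤ b j g)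
    (hint : ∀ j g, j < K → g ∈ admS T Spat j → Integrable (T.eterm ρ₀ j g) (μ j)) :
    LocCondStability T Spat K μ ρ₀ M b := by
  refine locCondStability_of_carrier_le_on_support T Spat K μ ρ₀ M _ hρ h0 hMm (fun j g hj hg y => ?_)
    (fun j g hj hg y hy => ?_) hint
  · rw [hM j g hj hg y]
    exact convexCarrier_nonneg _ _ _
  · rw [hM j g hj hg y]
    exact convexCarrier_le (hlam j g hj hg) (hVc j g hj hg y hy) (hV j g hj hg y hy) (hZ j g hj hg y hy) _ (hq j g hj hg y) _
      (h1 j g hj hg y hy) (h2 j g hj hg y hy) (hb j g hj hg y hy)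

end Junction

end Summit.QuantumFields.BalabanUV.T4Continuum.NE7b.ConvexTiltLCS

end
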